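import Summits.QuantumFields.YangMills.Theorems.CovariantDischargeClosureDefectBianchi
import Summits.QuantumFields.YangMills.Theorems.CovariantDischargeAvgPlaqFluxReading
import Summits.QuantumFields.YangMills.Theorems.CovariantDischargeDirectionNet
import Literature.MathematicalPhysics.QuantumFieldTheory.Balaban1983to89.B10Eq27TorusAxialLog
import Literature.MathematicalPhysics.QuantumFieldTheory.Balaban1983to89.B10Eq29TubeLine
import Literature.MathematicalPhysics.QuantumFieldTheory.Balaban1983to89.T4WilsonLinkAffine
import HarnessLib

/-!
# Line «sandwich_discharge» on crux `HistoryTailL` (stmt-QuantumFields-19936), stub `stub_sandwichSweepGapCapped` (S′), B6 door leaf (S0) «D6-Φ» —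
# «THE PLAQUETTE READING AS A 2-FORM ON ALL ORDERED PAIRS»: for an `SU(2)` torus configuration `U` (the door's comb-gauged `W̃`), the field
# `Φ(x; a, b) := ⟪v, Im q(U(∂(x; a, b)))⟫` (`q` = `su2Quat`, ALL ordered pairs via the torus word holonomy `holT`) is EXACTLY antisymmetric, bounded by
# `√3·θK` wherever the plaquettes are `θK`-small, agrees with the window reading `⟪v, imVec (su2Quat (plaqHol U q))⟫` on positively oriented plaquettes,
# and — read along the chart `w ↦ transl C w` — has alternating cube derivative `≤ √3·(60θK² + 6βθK)` where the links are `β`-close to `1`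

Cell `ym3-torus` (YM ladder rung R3 = continuum SU(2) Yang–Mills on the three-torus — a RUNG, NOT the Clay problem: not d = 4, not infinite volume,
not a mass gap); WIDTH helper seat `ym3-torus-px6` gen 8; `--supports stmt-QuantumFields-19936` (helper).  THEOREMS ONLY (0 `def`, default heartbeats).

WHY (px8 g7 DOOR SKELETON OF RECORD v3 f02daf0d, leaf (S0) «BRICK D6-Φ (px6 offered)», lines :258–267; B6-DOOR memo v3 D6 (W2) «Φ := F_q, the bulk row pays
the Bianchi defect `η_F` from ✓px6 `dTwo_read_plaqF_le_on_box`»).  The profile socket ✓`CovariantDischargeProfileSocket.exists_profile_socket` pairs the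
truncated potential against an arbitrary antisymmetric real 2-form `Φ` on the fine torus with three hypotheses (antisymmetry, a sup bound on the chart
box, an alternating-`d₂` bound on the chart box); the door instantiates `Φ` with the READING of the plaquette field of `W̃ := V^{axialT V c₀}`.  THIS FILE
supplies that instance: ★★`exists_doorPhi` returns `Φ` with the four clauses of the skeleton's `obtain ⟨Φ, hΦanti, hΦbox, hΦd2, hΦplaq⟩` VERBATIM, from
(i) `hplaq : ∀ q, dist1 (plaqHol U q) ≤ θK` (for `W̃`: `PlaqSmall θK V` + gauge invariance of `dist1 ∘ plaqHol`, the door's `hfin 0`), (ii)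
`hlink : ∀ w ∈ box 0 S₂, ∀ μ, dist1 (U ⟨transl C w, μ⟩) ≤ β` (the comb-lasso letter ✓`CovariantDischargeCombLassoStokes` on the pairing box), `‖v‖ ≤ 1`,
`0 ≤ θK ≤ 1`, `0 ≤ β`.  Route: §1 quaternion∕reading letters (`imVec (star q) = −imVec q`; the reading of the reversed plaquette is minus the reading;
`|⟪v, imVec q(g)⟫| ≤ ‖v‖·dist1 g` via ✓`CovariantDischargeDirectionNet.norm_imVec_le_dist1`; `dist1` of EVERY ordered plaquette word `≤ θK`); §2 the reading
as a continuous `ℝ`-linear functional on `M₂(ℂ)` with operator norm `≤ |v₀|+|v₁|+|v₂| ≤ √3‖v‖` (✓(M3) `abs_reading_le`, `sum_abs_le_sqrt_three_mul_norm`;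
`LinearMap.mkContinuous`, no `def`); §3 the `d₂` clause = ✓px6 `CovariantDischargeClosureDefectBianchi.dTwo_read_plaqF_le_on_box` on the PERIODIC PULL-BACK
`pull (unitsField (toUField U)) C` of lit ✓`B10Eq27TorusAxialLog` (`hol_pull`, `val_holT_unitsField`, `holT_toUField`, `U1_of_unitaryUnits`; ★p1 g13's
`…RegPrCritCurvGradLog` pattern for the all-orientation plaquette hypothesis), read through ✓(M3) `inner_imVec_su2Quat_eq`.  HONEST SCOPE: bookkeeping over
landed letters; NOTHING here proves the capped stub, `HistoryTailL`, or any summit statement; YM₃ on T³ is rung R3, not Clay. [folklore]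
-/

noncomputable section

open scoped BigOperators Matrix.Norms.L2Operator RealInnerProductSpace

namespace Summit.QuantumFields.YangMills.Theorems.CovariantDischargeDoorPhi

open Literature.MathematicalPhysics.QuantumFieldTheory.Balaban1983to89
open Literature.MathematicalPhysics.QuantumFieldTheory.Balaban1983to89.B4Eq19LatticeOperators (Zd unitVec box)
open Literature.MathematicalPhysics.QuantumLattice (su2Quat)
open T4ExpWindowSmallField (imVec dist1_eq_norm_coe_sub_one)
open B10Eq27TorusAxialLog (transl pull pull_apply holT hol_pull holT_plaqWord holT_plaqWord_swap holT_plaqWord_eq_plaqHol unitsField toUField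
  val_holT_unitsField holT_toUField val_suIncl val_unitsField unitsField_mem_unitaryUnits U1_of_unitaryUnits)
open B7Prop1Explicit (plaqWord U1 hol hol_mem norm_inv_sub_one_le)
open B8Ineq132 (plaqF)
open Summit.QuantumFields.YangMills.Theorems.CovariantDischargeAvgPlaqFluxReading (inner_imVec_su2Quat_eq abs_reading_le
  sum_abs_le_sqrt_three_mul_norm)
open Summit.QuantumFields.YangMills.Theorems.CovariantDischargeDirectionNet (norm_imVec_le_dist1)
open Summit.QuantumFields.YangMills.Theorems.CovariantDischargeClosureDefectBianchi (dTwo_read_plaqF_le_on_box)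

/-! ## §1 Quaternion ∕ reading letters -/

/-- Quaternion conjugation negates the imaginary vector: `imVec (star q) = −imVec q`. [folklore] -/
theorem imVec_star (q : Quaternion ℝ) : imVec (star q) = -imVec q := by
  ext i
  fin_cases i <;> simp [imVec]

/-- **The reading of the inverse is minus the reading**: `⟪v, imVec q(g⁻¹)⟫ = −⟪v, imVec q(g)⟫` on `SU(2)` (`q(g⁻¹) = star q(g)`). [folklore] -/
theorem inner_imVec_su2Quat_inv (v : EuclideanSpace ℝ (Fin 3)) (g : (Matrix.specialUnitaryGroup (Fin 2) ℂ)) : ⟪v, imVec (su2Quat g⁻¹)⟫ = -⟪v, imVec (su2Quat g)⟫ := by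
  rw [T4WilsonLinkAffine.su2Quat_inv, imVec_star, inner_neg_right]

/-- `|⟪v, imVec q(g)⟫| ≤ ‖v‖·dist1 g` (Cauchy–Schwarz + ✓`norm_imVec_le_dist1`). [folklore] -/
theorem abs_inner_imVec_le (v : EuclideanSpace ℝ (Fin 3)) (g : (Matrix.specialUnitaryGroup (Fin 2) ℂ)) : |⟪v, imVec (su2Quat g)⟫| ≤ ‖v‖ * GaugeGroup.dist1 g :=
  (abs_real_inner_le_norm _ _).trans (mul_le_mul_of_nonneg_left (norm_imVec_le_dist1 g) (norm_nonneg _))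

variable {P : Params} {j : ℕ}

/-- The degenerate plaquette word has trivial torus holonomy: `U(∂(x; a, a)) = 1`. [folklore] -/
theorem holT_plaqWord_self {G : Type*} [Group G] (U : GaugeField P j G) (x : Site P j) (a : Fin P.d) : holT U x (plaqWord a a) = 1 := by
  rw [holT_plaqWord]; group

/-- **Every ordered plaquette word is `θK`-small when the positively oriented plaquettes are**: `dist1 (U(∂(x; a, b))) ≤ θK` for all `a, b` from
`∀ q : Plaq, dist1 (plaqHol U q) ≤ θK` (`θK ≥ 0`; reversed orientation = inverse, `dist1_inv`; diagonal = `1`). [folklore] -/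
theorem dist1_holT_plaqWord_le {G : Type*} [GaugeGroup G] (U : GaugeField P j G) {θK : ℝ} (hθK0 : 0 ≤ θK)
    (hplaq : ∀ q : Plaq P j, GaugeGroup.dist1 (GaugeField.plaqHol U q) ≤ θK) (x : Site P j) (a b : Fin P.d) :
    GaugeGroup.dist1 (holT U x (plaqWord a b)) ≤ θK := by
  rcases lt_trichotomy a b with h | h | h
  · rw [holT_plaqWord_eq_plaqHol U ⟨x, a, b, h⟩]; exact hplaq _
  · subst h; rw [holT_plaqWord_self, GaugeGroup.dist1_one]; exact hθK0
  · rw [holT_plaqWord_swap, GaugeGroup.dist1_inv, holT_plaqWord_eq_plaqHol U ⟨x, b, a, h⟩]; exact hplaq _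

/-! ## §2 The reading as a continuous `ℝ`-linear functional on `M₂(ℂ)` -/

/-- **THE READING FUNCTIONAL**: `∃ λ : M₂(ℂ) →L[ℝ] ℝ`, `λ M = v₀·Im M₀₀ + v₁·Re M₀₁ + v₂·Im M₀₁`, `‖λ‖ ≤ |v₀|+|v₁|+|v₂|` (entries bounded by the operator norm,
✓(M3) `abs_reading_le`). [folklore] -/
theorem exists_readCLM (v : EuclideanSpace ℝ (Fin 3)) :
    ∃ lam : Matrix (Fin 2) (Fin 2) ℂ →L[ℝ] ℝ, (∀ M, lam M = v 0 * (M 0 0).im + v 1 * (M 0 1).re + v 2 * (M 0 1).im) ∧ ‖lam‖ ≤ |v 0| + |v 1| + |v 2| := by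
  let f : Matrix (Fin 2) (Fin 2) ℂ →ₗ[ℝ] ℝ :=
    { toFun := fun M => v 0 * (M 0 0).im + v 1 * (M 0 1).re + v 2 * (M 0 1).im
      map_add' := fun M N => by simp only [Matrix.add_apply, Complex.add_im, Complex.add_re]; ring
      map_smul' := fun r M => by
        simp only [Matrix.smul_apply, Complex.real_smul, Complex.mul_im, Complex.mul_re, Complex.ofReal_re, Complex.ofReal_im,
          RingHom.id_apply, smul_eq_mul]
        ring }
  have hb : ∀ M, ‖f M‖ ≤ (|v 0| + |v 1| + |v 2|) * ‖M‖ := fun M => by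
    rw [Real.norm_eq_abs]; exact abs_reading_le v M
  exact ⟨f.mkContinuous _ hb, fun M => rfl, LinearMap.mkContinuous_norm_le _ (by positivity) _⟩

/-! ## §3 ★★ The door's `Φ` -/

/-- ★★ **D6-Φ — THE PLAQUETTE READING AS A 2-FORM ON ALL ORDERED PAIRS, WITH THE PROFILE SOCKET's THREE HYPOTHESES.**  For an `SU(2)` torus configuration
`U` with `dist1 (U(∂q)) ≤ θK ≤ 1` on every positively oriented plaquette and `dist1 (U(y, y+e_μ)) ≤ β` on the bonds issuing from the chart box `transl C '' box 0 S₂`,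
and `‖v‖ ≤ 1`: the field `Φ(x; a, b) := ⟪v, imVec q(U(∂(x; a, b)))⟫` satisfies (1) EXACT antisymmetry, (2) `|Φ(transl C w; a, b)| ≤ √3·θK` (on any box — in fact
everywhere), (3) the alternating cube derivative along the chart `≤ √3·(60θK² + 6βθK)` on `box 0 S₂`, (4) `Φ(q.src; q.μ, q.ν) = ⟪v, imVec (su2Quat (plaqHol U q))⟫`.
[folklore] -/
theorem exists_doorPhi (U : GaugeField P j (Matrix.specialUnitaryGroup (Fin 2) ℂ)) (C : Site P j) (v : EuclideanSpace ℝ (Fin 3)) (hv : ‖v‖ ≤ 1) {θK β : ℝ} (hθK0 : 0 ≤ θK) (hθK1 : θK ≤ 1)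
    (hβ : 0 ≤ β) (S₁ S₂ : ℤ) (hplaq : ∀ q : Plaq P j, GaugeGroup.dist1 (GaugeField.plaqHol U q) ≤ θK)
    (hlink : ∀ w ∈ box (0 : Zd P.d) S₂, ∀ μ : Fin P.d, GaugeGroup.dist1 (U ⟨transl C w, μ⟩) ≤ β) :
    ∃ Φ : Site P j → Fin P.d → Fin P.d → ℝ,
      (∀ x a b, Φ x b a = -Φ x a b) ∧
      (∀ w ∈ box (0 : Zd P.d) S₁, ∀ a b, |Φ (transl C w) a b| ≤ Real.sqrt 3 * θK) ∧
      (∀ w ∈ box (0 : Zd P.d) S₂, ∀ κ a b,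
        |(Φ (transl C (w + unitVec κ)) a b - Φ (transl C w) a b) - (Φ (transl C (w + unitVec a)) κ b - Φ (transl C w) κ b)
          + (Φ (transl C (w + unitVec b)) κ a - Φ (transl C w) κ a)| ≤ Real.sqrt 3 * (60 * θK ^ 2 + 6 * β * θK)) ∧
      (∀ q : Plaq P j, Φ q.src q.μ q.ν = ⟪v, imVec (su2Quat (GaugeField.plaqHol U q))⟫) := by
  refine ⟨fun x a b => ⟪v, imVec (su2Quat (holT U x (plaqWord a b)))⟫, ?_, ?_, ?_, ?_⟩
  · -- (1) antisymmetry: reversed word = inverse, `q(g⁻¹) = star q(g)`, `imVec ∘ star = −imVec`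
    intro x a b
    show ⟪v, imVec (su2Quat (holT U x (plaqWord b a)))⟫ = -⟪v, imVec (su2Quat (holT U x (plaqWord a b)))⟫
    rw [holT_plaqWord_swap U x b a, inner_imVec_su2Quat_inv]
  · -- (2) sup bound: `|⟪v, imVec q(g)⟫| ≤ ‖v‖·dist1 g ≤ θK ≤ √3·θK`
    intro w _ a b
    have h1 := abs_inner_imVec_le v (holT U (transl C w) (plaqWord a b))
    have h2 := dist1_holT_plaqWord_le U hθK0 hplaq (transl C w) a b
    have h3 : (1 : ℝ) ≤ Real.sqrt 3 := by
      rw [show (1 : ℝ) = Real.sqrt 1 from Real.sqrt_one.symm]; exact Real.sqrt_le_sqrt (by norm_num)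
    calc |⟪v, imVec (su2Quat (holT U (transl C w) (plaqWord a b)))⟫| ≤ ‖v‖ * GaugeGroup.dist1 (holT U (transl C w) (plaqWord a b)) := h1
      _ ≤ 1 * θK := mul_le_mul hv h2 (GaugeGroup.dist1_nonneg _) zero_le_one
      _ ≤ Real.sqrt 3 * θK := by rw [one_mul]; exact le_mul_of_one_le_left hθK0 h3
  · -- (3) the alternating `d₂` along the chart: ✓`dTwo_read_plaqF_le_on_box` on the periodic pull-back
    letI : CStarAlgebra (Matrix (Fin 2) (Fin 2) ℂ) := B10Eq29TubeLine.cstarAlgebraMatrix 2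
    set Ut := unitsField (toUField U) with hUt
    set V : Zd P.d → Fin P.d → (Matrix (Fin 2) (Fin 2) ℂ)ˣ := pull Ut C with hV
    have hVm : ∀ z k, V z k ∈ U1 (Matrix (Fin 2) (Fin 2) ℂ) :=
      fun z k => U1_of_unitaryUnits (fun b => unitsField_mem_unitaryUnits (toUField U) b) ⟨transl C z, k⟩
    -- the matrix of every ordered plaquette word of the pull-back is the matrix of the `SU(2)` word holonomy
    have hmat : ∀ (z : Zd P.d) (a b : Fin P.d),
        plaqF V a b z = ((holT U (transl C z) (plaqWord a b) : (Matrix.specialUnitaryGroup (Fin 2) ℂ)) : Matrix (Fin 2) (Fin 2) ℂ) := by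
      intro z a b
      show ((hol V z (plaqWord a b) : (Matrix (Fin 2) (Fin 2) ℂ)ˣ) : Matrix (Fin 2) (Fin 2) ℂ) = _
      rw [hV, hol_pull, hUt, val_holT_unitsField, holT_toUField, val_suIncl]
    -- all-orientation plaquette hypothesis
    have hPl : ∀ (z : Zd P.d) (a b : Fin P.d), a ≠ b → ‖plaqF V a b z - 1‖ ≤ θK := by
      intro z a b _
      rw [hmat, ← dist1_eq_norm_coe_sub_one]
      exact dist1_holT_plaqWord_le U hθK0 hplaq (transl C z) a b
    -- tail bounds on the chart box
    have hxS : ∀ y ∈ box (0 : Zd P.d) S₂, ∀ μ : Fin P.d, ‖(V y μ : Matrix (Fin 2) (Fin 2) ℂ) - 1‖ ≤ β := by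
      intro y hy μ
      have e1 : (V y μ : Matrix (Fin 2) (Fin 2) ℂ) = ((U ⟨transl C y, μ⟩ : (Matrix.specialUnitaryGroup (Fin 2) ℂ)) : Matrix (Fin 2) (Fin 2) ℂ) := by
        rw [hV, pull_apply, hUt, val_unitsField]; rfl
      rw [e1, ← dist1_eq_norm_coe_sub_one]
      exact hlink y hy μ
    -- the reading functional and the dictionary `Φ (transl C w) a b = λ (plaqF V a b w − 1)`
    obtain ⟨lam, hlam, hlamn⟩ := exists_readCLM v
    have hF : ∀ (w : Zd P.d) (a b : Fin P.d),
        ⟪v, imVec (su2Quat (holT U (transl C w) (plaqWord a b)))⟫ = lam (plaqF V a b w - 1) := by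
      intro w a b
      rw [hlam, inner_imVec_su2Quat_eq, hmat]
    have hmain := dTwo_read_plaqF_le_on_box V hVm hθK0 hθK1 hβ hPl lam
      (fun w a b => ⟪v, imVec (su2Quat (holT U (transl C w) (plaqWord a b)))⟫) hF
      (fun w κ a b => (⟪v, imVec (su2Quat (holT U (transl C (w + unitVec κ)) (plaqWord a b)))⟫
          - ⟪v, imVec (su2Quat (holT U (transl C w) (plaqWord a b)))⟫)
        - (⟪v, imVec (su2Quat (holT U (transl C (w + unitVec a)) (plaqWord κ b)))⟫
          - ⟪v, imVec (su2Quat (holT U (transl C w) (plaqWord κ b)))⟫)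
        + (⟪v, imVec (su2Quat (holT U (transl C (w + unitVec b)) (plaqWord κ a)))⟫
          - ⟪v, imVec (su2Quat (holT U (transl C w) (plaqWord κ a)))⟫))
      (fun _ _ _ _ => rfl) 0 S₂ hxS
    -- `‖λ‖ ≤ |v₀|+|v₁|+|v₂| ≤ √3‖v‖ ≤ √3`
    have hlam3 : ‖lam‖ ≤ Real.sqrt 3 := by
      refine hlamn.trans ((sum_abs_le_sqrt_three_mul_norm v).trans ?_)
      exact mul_le_of_le_one_right (Real.sqrt_nonneg 3) hv
    have hpos : 0 ≤ 60 * θK ^ 2 + 6 * β * θK := by positivity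
    intro w hw κ a b
    exact (hmain w hw κ a b).trans (mul_le_mul_of_nonneg_right hlam3 hpos)
  · -- (4) agreement with the window reading on positively oriented plaquettes
    intro q
    show ⟪v, imVec (su2Quat (holT U q.src (plaqWord q.μ q.ν)))⟫ = _
    rw [holT_plaqWord_eq_plaqHol]

end Summit.QuantumFields.YangMills.Theorems.CovariantDischargeDoorPhi

end
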